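import Literature.NumberTheory.Rogawski1990.ArchBouazizStableFamilyLinear       -- ★ p851484 (LH3-p02 (g5), (S-lin) B): `ArchSmooth₂.finset_sum`, `integrable_descConj_of_uniformlyProper`; brings `stOrbFamH`, `chartOrbH`
import Literature.NumberTheory.Rogawski1990.ArchEndoscopicProductTestFunction     -- ★ (N1): `exists_archSmooth₂_prod` (pattern bumps on `H_∞`)
import Literature.NumberTheory.Automorphic.ArchEndoscopicChartOrbLocalPos         -- ★ (N2): `integral_descConj_pos_of_nonneg`; brings ★ `isOpenPosMeasure_quotientMeasure`
import Literature.NumberTheory.Automorphic.ArchEndoscopicChartOrbFree             -- ★ `toReal_chartHaarH_chartBoxImg_pos`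
import Literature.NumberTheory.Automorphic.ArchEndoscopicChartOrbitalContinuity   -- ★ `uniformlyProper_endoTorus`
import HarnessLib

/-!
# Non-negative test functions on `H_∞` positive on a prescribed compact set, and NON-VANISHING of their stable orbital families on the regular chart points with bounded
# split coordinates (Bouaziz 1994 §2.3, §5.1; Varadarajan 1989 §6 p. 229; Rogawski 1990 §8.2)

Topic `NumberTheory/Rogawski1990`; namespace `Literature.NumberTheory.Rogawski1990`.  THEOREMS ONLY (no `def`, no instance, no notation, no axiom, no named fact, no `sorry`).
Cell `pub/hodgecm-mathlib`, crux H413 (`stmt-HodgeConjecture-24833`), line LH3 (closer stub `stub_N9`, DIRECT ROAD), letter L3′ SURJ-OF-FORWARD road (RULING #22∕#23, LH3-plan (g4));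
binder∕assembler of record LH10-p01 (g5) (★ `bouazizSurjOfForward_of_parts`, p851480), organ (Σ-REG), sub-brick **(Σ4b) «NON-VANISHING `β`»** of the CLASS-FUNCTION MULTIPLIER road
(LH10-p01 (g5) 2026-09-02T12:38:43Z ∕ 12:47:06Z).  Author F0P3a-p04 (g25).  Count-neutral.

THE POINT.  The multiplier road (★ `ArchBouazizClassMultiplier`, (Σ4a)) realises a member `Ψ` of Bouaziz's space near a regular base class as `(F ∘ cl_H) · β` with
`F = (Ψ ∕ stOrbFamH β) ∘ σ`; it needs ONE `β ∈ C_c^∞(H_∞)` whose stable orbital family does NOT VANISH at the regular chart points near the base class.  Here: for every chart type `S`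
and every bound `R` there is a real non-negative `β ∈ C_c^∞(H_∞)` with `stOrbFamH L νH β S c ≠ 0` at EVERY `c ∈ RegS S` with `|x_w| ≤ R` at the split places (§5) — no base class,
no local section needed: the `T = ∅` term of the stable sum is the chart orbital integral of `β ≥ 0` at `endoTorus S c`, a POSITIVE real as soon as `β(endoTorus S c) > 0` (§3:
the invariant quotient measure charges open sets, ★ `isOpenPosMeasure_quotientMeasure`; the integrand is integrable at regular points, ★ `uniformlyProper_endoTorus`), the other
terms are `≥ 0`, and `R_S ≠ 0` on `RegS S` (★ `archRH_ne_zero_of_mem_regS`); the torus points with angles reduced mod `2π` and `|x_w| ≤ R` form a compact set (§4), on which a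
finite sum of ★ (N1) pattern bumps is positive (§1–§2).
* §1 `exists_real_archSmooth₂_pos_at (k₀)` — a real `β ≥ 0` in `C_c^∞(H_∞)` with `β k₀ > 0` (★ `exists_archSmooth₂_prod` at the place components of `k₀`).
* §2 `exists_real_archSmooth₂_pos_on (hE : IsCompact E)` — the same, positive on all of `E` (finite subcover, ★ `ArchSmooth₂.finset_sum`).
* §3 `chartOrbH_ofReal` (the chart functional of a real function is real), `chartOrbH_ofReal_re_nonneg`, **`chartOrbH_ofReal_re_pos`** (`c ∈ RegS S`, `β(endoTorus S c) > 0`),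
  `stableSum_chartOrbH_ofReal_re_pos`, **`stOrbFamH_ofReal_ne_zero`**.
* §4 `endoTorus_add_sum_angleShift`, `exists_mem_box_endoTorus_eq` (every chart point equals one with angle slots in `[0, 2π)` and the same split slots), the compact torus piece
  `isCompact_endoTorus_image_box`.
* §5 HEAD **`exists_archSmooth₂_stOrbFamH_ne_zero (L νH) (S) (R) : ∃ β, ArchSmooth₂ L β ∧ ∀ c ∈ RegS S, (∀ w ∈ S, |c w 0| ≤ R) → stOrbFamH L νH β S c ≠ 0`** (+ the real,
  non-negative reading `exists_real_archSmooth₂_stOrbFamH_ne_zero`).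
HONEST LABEL: L3′ stays XL∕PRINT-labelled ((Σ-WALL) PRINT, RULING #23) until paid; HC_CM is proved only modulo the 7 printed citations (2 remaining: hLiu418 = stmt-HodgeConjecture-24832,
h413 = stmt-HodgeConjecture-24833) until rung 0 closes; this file is measure plumbing and pays nothing by itself.

## References
* [Bouaziz1994IntegralesOrbitales] A. Bouaziz, *Intégrales orbitales sur les groupes de Lie réductifs*, Ann. Sci. ÉNS (4) 27 (1994) 573–609, §2.3 p. 578, §5.1 p. 588.
* [Varadarajan1989] V. S. Varadarajan, *An Introduction to Harmonic Analysis on Semisimple Lie Groups*, Cambridge Stud. Adv. Math. 16 (1989), §6 p. 229.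
* [Rogawski1990] J. D. Rogawski, *Automorphic Representations of Unitary Groups in Three Variables*, Ann. of Math. Stud. 123 (1990), §8.2 p. 122, §4.1 (4.1.1) p. 39.
* [DeitmarEchterhoff2014] A. Deitmar, S. Echterhoff, *Principles of Harmonic Analysis*, 2nd ed., Thm. 1.5.3.
-/

set_option autoImplicit false

noncomputable section

open MeasureTheory MeasureTheory.Measure NumberField NumberField.InfinitePlace Complex Set Function Filter Topology
open Literature.NumberTheory.Automorphic Literature.NumberTheory.Automorphic.UnitaryGroup Literature.NumberTheory.Automorphic.ArchCartan
open Literature.MeasureTheory.Group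
open scoped Classical

namespace Literature.NumberTheory.Rogawski1990

/-! ## §1 A real non-negative test function positive at a prescribed point -/

section Point

variable (L : Type) [Field L] [NumberField L] [IsCMField L]

set_option backward.isDefEq.respectTransparency false in
/-- **A REAL NON-NEGATIVE `C_c^∞(H_∞)` FUNCTION POSITIVE AT `k₀`** — the ★ (N1) pattern bump centred at the place components of `k₀` (value `1` there).
[cite: Rogawski1990, §14.3 p. 234] [cite: BorelJacquet1979, §4.1] -/
theorem exists_real_archSmooth₂_pos_at
    (k₀ : ↥(arch (↥(maximalRealSubfield L)) L (IsCMField.complexConj L) 2 (Matrix.of fun i j : Fin 2 => if i.val + j.val + 1 = 2 then (1 : L) else 0)) ×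
      ↥(arch (↥(maximalRealSubfield L)) L (IsCMField.complexConj L) 1 (Matrix.of fun i j : Fin 1 => if i.val + j.val + 1 = 1 then (1 : L) else 0))) :
    ∃ f : ↥(arch (↥(maximalRealSubfield L)) L (IsCMField.complexConj L) 2 (Matrix.of fun i j : Fin 2 => if i.val + j.val + 1 = 2 then (1 : L) else 0)) ×
        ↥(arch (↥(maximalRealSubfield L)) L (IsCMField.complexConj L) 1 (Matrix.of fun i j : Fin 1 => if i.val + j.val + 1 = 1 then (1 : L) else 0)) → ℝ,
      Continuous f ∧ (∀ k, 0 ≤ f k) ∧ 0 < f k₀ ∧ ArchSmooth₂ L (fun k => ((f k : ℝ) : ℂ)) := by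
  obtain ⟨fw, g, hfw, hg, harch⟩ :=
    exists_archSmooth₂_prod L (archPiEquivCM 2 L (Matrix.of fun i j : Fin 2 => if i.val + j.val + 1 = 2 then (1 : L) else 0) k₀.1) k₀.2
  refine ⟨fun k => (∏ w, fw w (archPiEquivCM 2 L (Matrix.of fun i j : Fin 2 => if i.val + j.val + 1 = 2 then (1 : L) else 0) k.1 w)) * g k.2, ?_, ?_, ?_, ?_⟩
  · have hc := harch.continuous
    have h := Complex.continuous_re.comp hc
    refine h.congr fun k => ?_
    show ((∏ w, ((fw w (archPiEquivCM 2 L (Matrix.of fun i j : Fin 2 => if i.val + j.val + 1 = 2 then (1 : L) else 0) k.1 w) : ℝ) : ℂ)) * ((g k.2 : ℝ) : ℂ)).re = _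
    rw [← Complex.ofReal_prod, ← Complex.ofReal_mul, Complex.ofReal_re]
  · exact fun k => mul_nonneg (Finset.prod_nonneg fun w _ => (hfw w).2.2.1 _) (hg.2.2.1 _)
  · refine mul_pos (Finset.prod_pos fun w _ => ?_) ?_
    · rw [(hfw w).2.2.2]; exact one_pos
    · rw [hg.2.2.2]; exact one_pos
  · refine (congrArg (ArchSmooth₂ L) ?_).mp harch
    funext k
    rw [Complex.ofReal_mul, Complex.ofReal_prod]

end Point

/-! ## §2 A real non-negative test function positive on a prescribed compact set -/

section Compact

variable (L : Type) [Field L] [NumberField L] [IsCMField L]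

/-- **A REAL NON-NEGATIVE `C_c^∞(H_∞)` FUNCTION POSITIVE ON A COMPACT SET** — a finite sum of the bumps of §1 over a finite subcover of `E` by their positivity sets
(★ `ArchSmooth₂.finset_sum`). [cite: Bouaziz1994IntegralesOrbitales, §2.3 p. 578] [cite: BorelJacquet1979, §4.1] -/
theorem exists_real_archSmooth₂_pos_on
    {E : Set (↥(arch (↥(maximalRealSubfield L)) L (IsCMField.complexConj L) 2 (Matrix.of fun i j : Fin 2 => if i.val + j.val + 1 = 2 then (1 : L) else 0)) ×
      ↥(arch (↥(maximalRealSubfield L)) L (IsCMField.complexConj L) 1 (Matrix.of fun i j : Fin 1 => if i.val + j.val + 1 = 1 then (1 : L) else 0)))} (hE : IsCompact E) :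
    ∃ f : ↥(arch (↥(maximalRealSubfield L)) L (IsCMField.complexConj L) 2 (Matrix.of fun i j : Fin 2 => if i.val + j.val + 1 = 2 then (1 : L) else 0)) ×
        ↥(arch (↥(maximalRealSubfield L)) L (IsCMField.complexConj L) 1 (Matrix.of fun i j : Fin 1 => if i.val + j.val + 1 = 1 then (1 : L) else 0)) → ℝ,
      Continuous f ∧ (∀ k, 0 ≤ f k) ∧ (∀ k ∈ E, 0 < f k) ∧ ArchSmooth₂ L (fun k => ((f k : ℝ) : ℂ)) := by
  choose f hfc hf0 hfpos hfa using exists_real_archSmooth₂_pos_at L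
  -- the positivity sets cover `E`
  have hcover : E ⊆ ⋃ k₀ ∈ E, {k | 0 < f k₀ k} := fun k hk => mem_iUnion₂.2 ⟨k, hk, hfpos k⟩
  obtain ⟨t, -, ht, hcov⟩ := hE.elim_finite_subcover_image (fun k₀ _ => isOpen_lt continuous_const (hfc k₀)) hcover
  refine ⟨fun k => ∑ k₀ ∈ ht.toFinset, f k₀ k, continuous_finsetSum _ fun k₀ _ => hfc k₀, fun k => Finset.sum_nonneg fun k₀ _ => hf0 k₀ k, fun k hk => ?_, ?_⟩
  · obtain ⟨k₀, hk₀, hk⟩ := mem_iUnion₂.1 (hcov hk)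
    exact Finset.sum_pos' (fun k₁ _ => hf0 k₁ k) ⟨k₀, ht.mem_toFinset.2 hk₀, hk⟩
  · have h := ArchSmooth₂.finset_sum ht.toFinset (aH := fun k₀ k => ((f k₀ k : ℝ) : ℂ)) fun k₀ _ => hfa k₀
    refine (congrArg (ArchSmooth₂ L) ?_).mp h
    funext k
    rw [Finset.sum_apply, Complex.ofReal_sum]

end Compact

/-! ## §3 The chart orbital functional of a real non-negative function is a non-negative real, positive when the function is positive at the chart point -/

section Orb

variable (L : Type) [Field L] [NumberField L] [IsCMField L]
  [MeasurableSpace (↥(arch (↥(maximalRealSubfield L)) L (IsCMField.complexConj L) 2 (Matrix.of fun i j : Fin 2 => if i.val + j.val + 1 = 2 then (1 : L) else 0)) ×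
      ↥(arch (↥(maximalRealSubfield L)) L (IsCMField.complexConj L) 1 (Matrix.of fun i j : Fin 1 => if i.val + j.val + 1 = 1 then (1 : L) else 0)))]
  [BorelSpace (↥(arch (↥(maximalRealSubfield L)) L (IsCMField.complexConj L) 2 (Matrix.of fun i j : Fin 2 => if i.val + j.val + 1 = 2 then (1 : L) else 0)) ×
      ↥(arch (↥(maximalRealSubfield L)) L (IsCMField.complexConj L) 1 (Matrix.of fun i j : Fin 1 => if i.val + j.val + 1 = 1 then (1 : L) else 0)))]
  (νH : Measure (↥(arch (↥(maximalRealSubfield L)) L (IsCMField.complexConj L) 2 (Matrix.of fun i j : Fin 2 => if i.val + j.val + 1 = 2 then (1 : L) else 0)) ×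
      ↥(arch (↥(maximalRealSubfield L)) L (IsCMField.complexConj L) 1 (Matrix.of fun i j : Fin 1 => if i.val + j.val + 1 = 1 then (1 : L) else 0))))

/-- **The chart orbital functional of a real function is real**: `chartOrbH L νH S (β : ℂ) c = ↑(dt_S(B_S) · ∫ β(y γ y⁻¹))`. [cite: Rogawski1990, §8.2 p. 122] -/
theorem chartOrbH_ofReal [IsFiniteMeasureOnCompacts νH] [νH.IsMulRightInvariant] (S : Finset {w : InfinitePlace L // IsComplex w})
    (f : ↥(arch (↥(maximalRealSubfield L)) L (IsCMField.complexConj L) 2 (Matrix.of fun i j : Fin 2 => if i.val + j.val + 1 = 2 then (1 : L) else 0)) ×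
      ↥(arch (↥(maximalRealSubfield L)) L (IsCMField.complexConj L) 1 (Matrix.of fun i j : Fin 1 => if i.val + j.val + 1 = 1 then (1 : L) else 0)) → ℝ)
    (c : {w : InfinitePlace L // IsComplex w} → Fin 3 → ℝ) :
    chartOrbH L νH S (fun k => ((f k : ℝ) : ℂ)) c =
      (letI : MeasurableSpace ((↥(arch (↥(maximalRealSubfield L)) L (IsCMField.complexConj L) 2 (Matrix.of fun i j : Fin 2 => if i.val + j.val + 1 = 2 then (1 : L) else 0)) ×
          ↥(arch (↥(maximalRealSubfield L)) L (IsCMField.complexConj L) 1 (Matrix.of fun i j : Fin 1 => if i.val + j.val + 1 = 1 then (1 : L) else 0))) ⧸ chartTorusH L S) := borel _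
       (((chartHaarH L S (chartBoxImg L S)).toReal *
          ∫ y, descConj (endoTorus L S c) (chartTorusH L S) (forall_mem_chartTorusH_comm L S c) f y ∂(chartQuotientMeasureH L νH S) : ℝ) : ℂ)) := by
  letI : MeasurableSpace ((↥(arch (↥(maximalRealSubfield L)) L (IsCMField.complexConj L) 2 (Matrix.of fun i j : Fin 2 => if i.val + j.val + 1 = 2 then (1 : L) else 0)) ×
      ↥(arch (↥(maximalRealSubfield L)) L (IsCMField.complexConj L) 1 (Matrix.of fun i j : Fin 1 => if i.val + j.val + 1 = 1 then (1 : L) else 0))) ⧸ chartTorusH L S) := borel _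
  haveI : BorelSpace ((↥(arch (↥(maximalRealSubfield L)) L (IsCMField.complexConj L) 2 (Matrix.of fun i j : Fin 2 => if i.val + j.val + 1 = 2 then (1 : L) else 0)) ×
      ↥(arch (↥(maximalRealSubfield L)) L (IsCMField.complexConj L) 1 (Matrix.of fun i j : Fin 1 => if i.val + j.val + 1 = 1 then (1 : L) else 0))) ⧸ chartTorusH L S) := ⟨rfl⟩
  rw [chartOrbH_def]
  have hcomp : descConj (endoTorus L S c) (chartTorusH L S) (forall_mem_chartTorusH_comm L S c)
        (fun k : ↥(arch (↥(maximalRealSubfield L)) L (IsCMField.complexConj L) 2 (Matrix.of fun i j : Fin 2 => if i.val + j.val + 1 = 2 then (1 : L) else 0)) ×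
          ↥(arch (↥(maximalRealSubfield L)) L (IsCMField.complexConj L) 1 (Matrix.of fun i j : Fin 1 => if i.val + j.val + 1 = 1 then (1 : L) else 0)) => ((f k : ℝ) : ℂ)) =
      fun y => ((descConj (endoTorus L S c) (chartTorusH L S) (forall_mem_chartTorusH_comm L S c) f y : ℝ) : ℂ) := by
    funext y
    induction y using QuotientGroup.induction_on with
    | H g => rfl
  rw [hcomp, integral_complex_ofReal, Complex.ofReal_mul]

/-- **For `β ≥ 0` the chart orbital functional is a non-negative real** (`∫` of a non-negative function; Bochner integral `0` if not integrable). [cite: Rogawski1990, §8.2 p. 122] -/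
theorem chartOrbH_ofReal_re_nonneg [IsFiniteMeasureOnCompacts νH] [νH.IsMulRightInvariant] (S : Finset {w : InfinitePlace L // IsComplex w})
    {f : ↥(arch (↥(maximalRealSubfield L)) L (IsCMField.complexConj L) 2 (Matrix.of fun i j : Fin 2 => if i.val + j.val + 1 = 2 then (1 : L) else 0)) ×
      ↥(arch (↥(maximalRealSubfield L)) L (IsCMField.complexConj L) 1 (Matrix.of fun i j : Fin 1 => if i.val + j.val + 1 = 1 then (1 : L) else 0)) → ℝ}
    (h0 : ∀ k, 0 ≤ f k) (c : {w : InfinitePlace L // IsComplex w} → Fin 3 → ℝ) :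
    0 ≤ (chartOrbH L νH S (fun k => ((f k : ℝ) : ℂ)) c).re ∧ (chartOrbH L νH S (fun k => ((f k : ℝ) : ℂ)) c).im = 0 := by
  letI : MeasurableSpace ((↥(arch (↥(maximalRealSubfield L)) L (IsCMField.complexConj L) 2 (Matrix.of fun i j : Fin 2 => if i.val + j.val + 1 = 2 then (1 : L) else 0)) ×
      ↥(arch (↥(maximalRealSubfield L)) L (IsCMField.complexConj L) 1 (Matrix.of fun i j : Fin 1 => if i.val + j.val + 1 = 1 then (1 : L) else 0))) ⧸ chartTorusH L S) := borel _
  haveI : BorelSpace ((↥(arch (↥(maximalRealSubfield L)) L (IsCMField.complexConj L) 2 (Matrix.of fun i j : Fin 2 => if i.val + j.val + 1 = 2 then (1 : L) else 0)) ×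
      ↥(arch (↥(maximalRealSubfield L)) L (IsCMField.complexConj L) 1 (Matrix.of fun i j : Fin 1 => if i.val + j.val + 1 = 1 then (1 : L) else 0))) ⧸ chartTorusH L S) := ⟨rfl⟩
  rw [chartOrbH_ofReal, Complex.ofReal_re, Complex.ofReal_im]
  refine ⟨mul_nonneg ENNReal.toReal_nonneg (integral_nonneg fun y => ?_), rfl⟩
  induction y using QuotientGroup.induction_on with
  | H g => exact h0 _

/-- **POSITIVITY**: for a Haar measure `νH`, `β ≥ 0` continuous with compact support, a REGULAR chart point `c` (closed orbit: the quotient integrand is integrable, ★ `uniformlyProper_endoTorus`)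
and `β(endoTorus S c) > 0`, the chart orbital functional is a POSITIVE real (the invariant quotient measure charges open sets, ★ `isOpenPosMeasure_quotientMeasure`; the box mass
is positive, ★ `toReal_chartHaarH_chartBoxImg_pos`). [cite: Rogawski1990, §8.2 p. 122] [cite: DeitmarEchterhoff2014, Thm. 1.5.3] -/
theorem chartOrbH_ofReal_re_pos [νH.IsHaarMeasure] [νH.IsMulRightInvariant] (S : Finset {w : InfinitePlace L // IsComplex w})
    {f : ↥(arch (↥(maximalRealSubfield L)) L (IsCMField.complexConj L) 2 (Matrix.of fun i j : Fin 2 => if i.val + j.val + 1 = 2 then (1 : L) else 0)) ×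
      ↥(arch (↥(maximalRealSubfield L)) L (IsCMField.complexConj L) 1 (Matrix.of fun i j : Fin 1 => if i.val + j.val + 1 = 1 then (1 : L) else 0)) → ℝ}
    (hf : Continuous f) (hfc : HasCompactSupport f) (h0 : ∀ k, 0 ≤ f k) {c : {w : InfinitePlace L // IsComplex w} → Fin 3 → ℝ} (hc : c ∈ RegS S)
    (hpos : 0 < f (endoTorus L S c)) :
    0 < (chartOrbH L νH S (fun k => ((f k : ℝ) : ℂ)) c).re := by
  letI : MeasurableSpace ((↥(arch (↥(maximalRealSubfield L)) L (IsCMField.complexConj L) 2 (Matrix.of fun i j : Fin 2 => if i.val + j.val + 1 = 2 then (1 : L) else 0)) ×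
      ↥(arch (↥(maximalRealSubfield L)) L (IsCMField.complexConj L) 1 (Matrix.of fun i j : Fin 1 => if i.val + j.val + 1 = 1 then (1 : L) else 0))) ⧸ chartTorusH L S) := borel _
  haveI : BorelSpace ((↥(arch (↥(maximalRealSubfield L)) L (IsCMField.complexConj L) 2 (Matrix.of fun i j : Fin 2 => if i.val + j.val + 1 = 2 then (1 : L) else 0)) ×
      ↥(arch (↥(maximalRealSubfield L)) L (IsCMField.complexConj L) 1 (Matrix.of fun i j : Fin 1 => if i.val + j.val + 1 = 1 then (1 : L) else 0))) ⧸ chartTorusH L S) := ⟨rfl⟩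
  rw [chartOrbH_ofReal, Complex.ofReal_re]
  haveI := locallyCompactSpace_chartTorusH L S
  haveI := isHaarMeasure_chartHaarH L S
  haveI := isInvInvariant_chartHaarH L S
  have hopen : (chartQuotientMeasureH L νH S).IsOpenPosMeasure := by
    unfold chartQuotientMeasureH
    exact isOpenPosMeasure_quotientMeasure (chartTorusH L S) (isClosed_chartTorusH L S) (chartHaarH L S) νH
  haveI := hopen
  haveI : IsFiniteMeasureOnCompacts (chartQuotientMeasureH L νH S) := by
    unfold chartQuotientMeasureH
    infer_instance
  have hint : Integrable (descConj (endoTorus L S c) (chartTorusH L S) (forall_mem_chartTorusH_comm L S c) f) (chartQuotientMeasureH L νH S) :=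
    integrable_descConj_of_uniformlyProper (chartTorusH L S) (forall_mem_chartTorusH_comm L S) (uniformlyProper_endoTorus L S) (chartQuotientMeasureH L νH S) hf hfc hc
  refine mul_pos (toReal_chartHaarH_chartBoxImg_pos L S) ?_
  exact integral_descConj_pos_of_nonneg (endoTorus L S c) (chartTorusH L S) (forall_mem_chartTorusH_comm L S c) (chartQuotientMeasureH L νH S) hf h0 hint
    (x₀ := 1) (by simpa using hpos.ne')

/-- **THE STABLE SUM of the chart functionals of `β ≥ 0` HAS POSITIVE REAL PART** as soon as `β(endoTorus S c) > 0` at the regular chart point `c` (the `T = ∅` term is positive,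
the flipped terms are `≥ 0`). [cite: Rogawski1990, §4.1 (4.1.1) p. 39] [cite: Shelstad1979, §4 p. 23] -/
theorem stableSum_chartOrbH_ofReal_re_pos [νH.IsHaarMeasure] [νH.IsMulRightInvariant] (S : Finset {w : InfinitePlace L // IsComplex w})
    {f : ↥(arch (↥(maximalRealSubfield L)) L (IsCMField.complexConj L) 2 (Matrix.of fun i j : Fin 2 => if i.val + j.val + 1 = 2 then (1 : L) else 0)) ×
      ↥(arch (↥(maximalRealSubfield L)) L (IsCMField.complexConj L) 1 (Matrix.of fun i j : Fin 1 => if i.val + j.val + 1 = 1 then (1 : L) else 0)) → ℝ}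
    (hf : Continuous f) (hfc : HasCompactSupport f) (h0 : ∀ k, 0 ≤ f k) {c : {w : InfinitePlace L // IsComplex w} → Fin 3 → ℝ} (hc : c ∈ RegS S)
    (hpos : 0 < f (endoTorus L S c)) :
    0 < (stableSum S (chartOrbH L νH S (fun k => ((f k : ℝ) : ℂ))) c).re := by
  rw [stableSum_def, Complex.re_sum]
  have hmem : (∅ : Finset {w : InfinitePlace L // IsComplex w}) ∈ (Finset.univ \ S).powerset := Finset.mem_powerset.2 (Finset.empty_subset _)
  rw [← Finset.add_sum_erase _ _ hmem]
  refine add_pos_of_pos_of_nonneg ?_ (Finset.sum_nonneg fun T _ => (chartOrbH_ofReal_re_nonneg L νH S h0 _).1)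
  rw [flipSet_empty]
  exact chartOrbH_ofReal_re_pos L νH S hf hfc h0 hc hpos

/-- **NON-VANISHING OF THE STABLE ORBITAL FAMILY OF `β ≥ 0` AT A REGULAR CHART POINT WHERE `β(endoTorus S c) > 0`** (`R_S ≠ 0` on `RegS S`, ★ `archRH_ne_zero_of_mem_regS`).
[cite: Shelstad1979, §4 p. 22] [cite: Rogawski1990, §4.1 (4.1.1) p. 39] -/
theorem stOrbFamH_ofReal_ne_zero [νH.IsHaarMeasure] [νH.IsMulRightInvariant] (S : Finset {w : InfinitePlace L // IsComplex w})
    {f : ↥(arch (↥(maximalRealSubfield L)) L (IsCMField.complexConj L) 2 (Matrix.of fun i j : Fin 2 => if i.val + j.val + 1 = 2 then (1 : L) else 0)) ×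
      ↥(arch (↥(maximalRealSubfield L)) L (IsCMField.complexConj L) 1 (Matrix.of fun i j : Fin 1 => if i.val + j.val + 1 = 1 then (1 : L) else 0)) → ℝ}
    (hf : Continuous f) (hfc : HasCompactSupport f) (h0 : ∀ k, 0 ≤ f k) {c : {w : InfinitePlace L // IsComplex w} → Fin 3 → ℝ} (hc : c ∈ RegS S)
    (hpos : 0 < f (endoTorus L S c)) :
    stOrbFamH L νH (fun k => ((f k : ℝ) : ℂ)) S c ≠ 0 := by
  rw [stOrbFamH_of_mem_regS L νH _ S hc, ← stableSum_def]
  refine mul_ne_zero (archRH_ne_zero_of_mem_regS hc) fun h => ?_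
  have hre := stableSum_chartOrbH_ofReal_re_pos L νH S hf hfc h0 hc hpos
  rw [h, Complex.zero_re] at hre
  exact lt_irrefl _ hre

end Orb

/-! ## §4 Reduction of the angle slots mod `2π`; the compact torus piece -/

section Box

variable (L : Type) [Field L] [NumberField L] [IsCMField L]

/-- **THE CHART SEES THE ANGLE SLOTS ONLY THROUGH `e^{iθ}`**: two coordinates with the same split slots `c w 0` (`w ∈ S`) and the same `Circle.exp` of every other slot give the same
chart point (★ `hypBlockGL_eq_of_circleExp_eq`, ★ `coe_endoBlock…`, ★ `endoCircle`). [cite: Rogawski1990, §3.6 p. 31; §8.2 p. 122] -/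
theorem endoTorus_eq_of_circleExp_eq (S : Finset {w : InfinitePlace L // IsComplex w}) {c c' : {w : InfinitePlace L // IsComplex w} → Fin 3 → ℝ}
    (h0 : ∀ w, w ∈ S → c w 0 = c' w 0) (h : ∀ w i, (w ∉ S ∨ i ≠ 0) → Circle.exp (c w i) = Circle.exp (c' w i)) :
    endoTorus L S c = endoTorus L S c' := by
  have hB : endoBlock L S c = endoBlock L S c' := by
    funext w
    by_cases hw : w ∈ S
    · unfold endoBlock
      rw [if_pos hw, if_pos hw, Subtype.mk.injEq, h0 w hw]
      exact hypBlockGL_eq_of_circleExp_eq _ (h w 2 (Or.inr (by decide)))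
    · unfold endoBlock
      rw [if_neg hw, if_neg hw, Subtype.mk.injEq, h w 0 (Or.inl hw), h w 2 (Or.inl hw)]
  have hC : endoCircle L c = endoCircle L c' := by
    funext w
    unfold endoCircle
    rw [Subtype.mk.injEq, h w 1 (Or.inr (by decide))]
  unfold endoTorus
  rw [hB, hC]

/-- **REDUCTION MOD `2π`**: every chart point is the chart point of a coordinate with all angle slots in `[0, 2π)` and the same split slots (`toIcoMod` slot by slot; ★ `Circle.periodic_exp`).
[cite: Shelstad1979, §4 p. 22] [cite: Rogawski1990, §8.2 p. 122] -/
theorem exists_reduced_endoTorus_eq (S : Finset {w : InfinitePlace L // IsComplex w}) (c : {w : InfinitePlace L // IsComplex w} → Fin 3 → ℝ) :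
    ∃ c' : {w : InfinitePlace L // IsComplex w} → Fin 3 → ℝ, (∀ w, w ∈ S → c' w 0 = c w 0) ∧ (∀ w i, (w ∉ S ∨ i ≠ 0) → c' w i ∈ Set.Ico 0 (2 * Real.pi)) ∧
      endoTorus L S c' = endoTorus L S c := by
  refine ⟨fun w i => if w ∈ S ∧ i = 0 then c w i else toIcoMod Real.two_pi_pos 0 (c w i), fun w hw => by simp [hw], fun w i hwi => ?_, ?_⟩
  · have hne : ¬ (w ∈ S ∧ i = 0) := fun hh => hwi.elim (fun h1 => h1 hh.1) (fun h2 => h2 hh.2)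
    simp only [hne, if_false]
    simpa using toIcoMod_mem_Ico Real.two_pi_pos 0 (c w i)
  · refine endoTorus_eq_of_circleExp_eq L S (fun w hw => by simp [hw]) fun w i hwi => ?_
    have hne : ¬ (w ∈ S ∧ i = 0) := fun hh => hwi.elim (fun h1 => h1 hh.1) (fun h2 => h2 hh.2)
    simp only [hne, if_false]
    rw [toIcoMod, zsmul_eq_mul]
    exact Circle.periodic_exp.sub_int_mul_eq (toIcoDiv Real.two_pi_pos 0 (c w i))

/-- **THE COMPACT TORUS PIECE**: the chart points with all coordinates in `[−M, M]` form a compact subset of `H_∞` (continuous image of a closed box, ★ `continuous_endoTorus`).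
[cite: Bouaziz1994IntegralesOrbitales, §2.3 p. 578] -/
theorem isCompact_endoTorus_image_box (S : Finset {w : InfinitePlace L // IsComplex w}) (M : ℝ) :
    IsCompact (endoTorus L S '' {c : {w : InfinitePlace L // IsComplex w} → Fin 3 → ℝ | ∀ w i, c w i ∈ Set.Icc (-M) M}) := by
  have hbox : {c : {w : InfinitePlace L // IsComplex w} → Fin 3 → ℝ | ∀ w i, c w i ∈ Set.Icc (-M) M} =
      Set.Icc (fun _ _ => -M) (fun _ _ => M) := by
    ext c
    simp only [Set.mem_setOf_eq, Set.mem_Icc, Pi.le_def]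
    exact ⟨fun h => ⟨fun w i => (h w i).1, fun w i => (h w i).2⟩, fun h w i => ⟨h.1 w i, h.2 w i⟩⟩
  rw [hbox]
  exact isCompact_Icc.image (continuous_endoTorus L S)

/-- Every chart point with split slots bounded by `R` lies in the compact torus piece of size `max R (2π)` (after reducing the angles). [cite: Shelstad1979, §4 p. 22] -/
theorem endoTorus_mem_image_box (S : Finset {w : InfinitePlace L // IsComplex w}) {R : ℝ} {c : {w : InfinitePlace L // IsComplex w} → Fin 3 → ℝ}
    (hc : ∀ w, w ∈ S → |c w 0| ≤ R) :
    endoTorus L S c ∈ endoTorus L S '' {c : {w : InfinitePlace L // IsComplex w} → Fin 3 → ℝ | ∀ w i, c w i ∈ Set.Icc (-(max R (2 * Real.pi))) (max R (2 * Real.pi))} := by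
  obtain ⟨c', h0, hI, heq⟩ := exists_reduced_endoTorus_eq L S c
  refine ⟨c', fun w i => ?_, heq⟩
  by_cases hwi : w ∈ S ∧ i = 0
  · obtain ⟨hw, rfl⟩ := hwi
    rw [h0 w hw]
    have h := hc w hw
    rw [abs_le] at h
    exact ⟨by linarith [h.1, le_max_left R (2 * Real.pi)], h.2.trans (le_max_left _ _)⟩
  · have hwi' : w ∉ S ∨ i ≠ 0 := by
      by_cases hw : w ∈ S
      · exact Or.inr fun hi => hwi ⟨hw, hi⟩
      · exact Or.inl hw
    have h := hI w i hwi'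
    exact ⟨by linarith [h.1, le_max_right R (2 * Real.pi), Real.two_pi_pos], h.2.le.trans (le_max_right _ _)⟩

end Box

/-! ## §5 The head: a test function whose stable orbital family does not vanish at the regular chart points with bounded split slots -/

section Head

variable (L : Type) [Field L] [NumberField L] [IsCMField L]
  [MeasurableSpace (↥(arch (↥(maximalRealSubfield L)) L (IsCMField.complexConj L) 2 (Matrix.of fun i j : Fin 2 => if i.val + j.val + 1 = 2 then (1 : L) else 0)) ×
      ↥(arch (↥(maximalRealSubfield L)) L (IsCMField.complexConj L) 1 (Matrix.of fun i j : Fin 1 => if i.val + j.val + 1 = 1 then (1 : L) else 0)))]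
  [BorelSpace (↥(arch (↥(maximalRealSubfield L)) L (IsCMField.complexConj L) 2 (Matrix.of fun i j : Fin 2 => if i.val + j.val + 1 = 2 then (1 : L) else 0)) ×
      ↥(arch (↥(maximalRealSubfield L)) L (IsCMField.complexConj L) 1 (Matrix.of fun i j : Fin 1 => if i.val + j.val + 1 = 1 then (1 : L) else 0)))]
  (νH : Measure (↥(arch (↥(maximalRealSubfield L)) L (IsCMField.complexConj L) 2 (Matrix.of fun i j : Fin 2 => if i.val + j.val + 1 = 2 then (1 : L) else 0)) ×
      ↥(arch (↥(maximalRealSubfield L)) L (IsCMField.complexConj L) 1 (Matrix.of fun i j : Fin 1 => if i.val + j.val + 1 = 1 then (1 : L) else 0))))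
  [νH.IsHaarMeasure] [νH.IsMulRightInvariant]

/-- **(Σ4b) A REAL NON-NEGATIVE TEST FUNCTION WHOSE STABLE ORBITAL FAMILY DOES NOT VANISH AT THE REGULAR CHART POINTS WITH `|x_w| ≤ R`**: a finite sum of pattern bumps positive on
the compact torus piece (§2, §4); at a regular `c` the stable sum has positive real part (§3) and `R_S(c) ≠ 0`. [cite: Bouaziz1994IntegralesOrbitales, §5.1 p. 588]
[cite: Varadarajan1989, §6 p. 229] [cite: Rogawski1990, §8.2 p. 122] -/
theorem exists_real_archSmooth₂_stOrbFamH_ne_zero (S : Finset {w : InfinitePlace L // IsComplex w}) (R : ℝ) :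
    ∃ f : ↥(arch (↥(maximalRealSubfield L)) L (IsCMField.complexConj L) 2 (Matrix.of fun i j : Fin 2 => if i.val + j.val + 1 = 2 then (1 : L) else 0)) ×
        ↥(arch (↥(maximalRealSubfield L)) L (IsCMField.complexConj L) 1 (Matrix.of fun i j : Fin 1 => if i.val + j.val + 1 = 1 then (1 : L) else 0)) → ℝ,
      Continuous f ∧ (∀ k, 0 ≤ f k) ∧ ArchSmooth₂ L (fun k => ((f k : ℝ) : ℂ)) ∧
      ∀ c : {w : InfinitePlace L // IsComplex w} → Fin 3 → ℝ, c ∈ RegS S → (∀ w, w ∈ S → |c w 0| ≤ R) → stOrbFamH L νH (fun k => ((f k : ℝ) : ℂ)) S c ≠ 0 := by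
  obtain ⟨f, hfc, hf0, hfpos, hfa⟩ := exists_real_archSmooth₂_pos_on L (isCompact_endoTorus_image_box L S (max R (2 * Real.pi)))
  have hfs : HasCompactSupport f := by
    have h := hfa.hasCompactSupport.comp_left Complex.zero_re
    refine (congrArg HasCompactSupport ?_).mp h
    funext k
    exact Complex.ofReal_re _
  refine ⟨f, hfc, hf0, hfa, fun c hc hR => ?_⟩
  exact stOrbFamH_ofReal_ne_zero L νH S hfc hfs hf0 hc (hfpos _ (endoTorus_mem_image_box L S hR))

/-- **(Σ4b), `ℂ`-VALUED HEAD**: for every chart type `S` and bound `R` there is `β ∈ C_c^∞(H_∞)` with `stOrbFamH L νH β S c ≠ 0` at every `c ∈ RegS S` with `|c w 0| ≤ R` at the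
split places. [cite: Bouaziz1994IntegralesOrbitales, §5.1 p. 588] [cite: Varadarajan1989, §6 p. 229] -/
theorem exists_archSmooth₂_stOrbFamH_ne_zero (S : Finset {w : InfinitePlace L // IsComplex w}) (R : ℝ) :
    ∃ β : ↥(arch (↥(maximalRealSubfield L)) L (IsCMField.complexConj L) 2 (Matrix.of fun i j : Fin 2 => if i.val + j.val + 1 = 2 then (1 : L) else 0)) ×
        ↥(arch (↥(maximalRealSubfield L)) L (IsCMField.complexConj L) 1 (Matrix.of fun i j : Fin 1 => if i.val + j.val + 1 = 1 then (1 : L) else 0)) → ℂ,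
      ArchSmooth₂ L β ∧ ∀ c : {w : InfinitePlace L // IsComplex w} → Fin 3 → ℝ, c ∈ RegS S → (∀ w, w ∈ S → |c w 0| ≤ R) → stOrbFamH L νH β S c ≠ 0 := by
  obtain ⟨f, -, -, hfa, hne⟩ := exists_real_archSmooth₂_stOrbFamH_ne_zero L νH S R
  exact ⟨fun k => ((f k : ℝ) : ℂ), hfa, hne⟩

end Head

end Literature.NumberTheory.Rogawski1990

end
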